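import Summits.BirchSwinnertonDyer.BirchSwinnertonDyer.Theorems.ResidualThetaTransportAtTwoThetaLayerLambdaCongruenceAtTwoCrossingPairingPerfect
import HarnessLib

/-!
# Crux `ThetaLayerLambdaCongruenceAtTwo` (stmt-BirchSwinnertonDyer-20688, route ResidualThetaTransportAtTwo), line
# `birth` v13 — SD floor: the perfect crossing pairing transported to the `𝕋_ℤ`-module carrier `periodHomologyHecke N` of the named
# fact `periodHomology_exists_heckeSelfAdjoint_perfectPairing` (width seat bsd-wall-rtt-p3-w2 g8;
# `--supports stmt-BirchSwinnertonDyer-20688 --as helper`; closes nothing)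

HONEST FRAMING. One transport THEOREM. It puts `…CrossingPairingPerfect.exists_perfect_crossingPairing` in the exact carrier and shape of
the named fact IP (`∃ B : periodHomologyHecke N →+ periodHomologyHecke N →+ ℤ, Function.Bijective B ∧ …`) EXCEPT for the Hecke clause
`∀ t x y, B (t • x) y = B x (t • y)`, which is NOT proved (it needs Merel's adjointness of Hecke correspondences for intersection products and,
for `U_q`, the Fricke twist — bricks S5/S6 of `Cruxes/…/Lines/birth-sd2-architecture.md`). So IP is NOT claimed; BSD is not proved by any of this.

WHAT (`exists_perfect_crossingPairing_hecke`): for `N ≥ 1` there is a bi-additive `B` on `periodHomologyHecke N` (same carrier as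
`periodHomology N`), bijective as `Λ → Hom(Λ, ℤ)`, with `B {∞, γ∞} {∞, γ'∞} =` the signed crossing count of a dual chain of `γ` with a
Manin chain of `γ'`. A successor proving the Hecke clause for THIS `B` twisted by `w_N` closes IP, hence (`heckeSelfDual_torsionBy_J0_of_perfectPairing`)
the print stub SD of skeleton v13.

References: [Merel1995Homologie] §1.2–2.3; [Manin1972] Thm. 1.9.
-/

set_option autoImplicit false

noncomputable section

-- justification: the `Summit.BirchSwinnertonDyer.BirchSwinnertonDyer.…` path repeats a component (route-file convention)
set_option linter.dupNamespace false

open scoped Classical MatrixGroups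

open CongruenceSubgroup Matrix.SpecialLinearGroup ModularGroup
open Literature.NumberTheory.EllipticCurves.ModularForms

namespace Summit.BirchSwinnertonDyer.BirchSwinnertonDyer.Theorems.ThetaLayerLambdaCongruenceAtTwo

section Transport

variable {N : ℕ} [NeZero N]

/-- **Perfect crossing pairing on the `𝕋_ℤ`-module `Λ = periodHomologyHecke N`** (the carrier of the named fact IP): bi-additive,
bijective as `Λ → Hom(Λ, ℤ)`, and equal on period functionals to the signed crossing count of a dual chain of `γ` with a Manin chain
of `γ'`. The Hecke self-adjointness clause of IP is NOT included. [cite: Merel1995Homologie, §1.2] [cite: Manin1972, Thm. 1.9] -/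
theorem exists_perfect_crossingPairing_hecke :
    ∃ B : periodHomologyHecke N →+ (periodHomologyHecke N →+ ℤ), Function.Bijective B ∧ ∀ (γ γ' : Gamma0 N) (D L : List SL(2, ℤ)),
      (∀ {A : Type} [AddCommGroup A] (G : SL(2, ℤ) → A), (∀ x, G (x * (S * T⁻¹)) = G x) → (∀ x, G (-x) = G x) →
        (D.map fun h ↦ G h - G (h * S)).sum = G (γ : SL(2, ℤ)) - G 1) →
      (∀ {A : Type} [AddCommGroup A] (F : SL(2, ℤ) → A), (∀ g, F (g * T) = F g) → (∀ g, F (-g) = F g) →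
        (L.map fun g ↦ F g - F (g * S)).sum = F (γ' : SL(2, ℤ)) - F 1) →
      B ⟨periodFunctional N γ, (mem_periodHomologyHecke N).mpr (periodFunctional_mem_periodHomology N γ)⟩
        ⟨periodFunctional N γ', (mem_periodHomologyHecke N).mpr (periodFunctional_mem_periodHomology N γ')⟩ =
        (L.map fun g ↦ (D.map fun h ↦ (Pi.single ((h⁻¹ : SL(2, ℤ)) : Gamma0Coset N) (1 : ℤ) -
          Pi.single (((h * S)⁻¹ : SL(2, ℤ)) : Gamma0Coset N) 1 : Gamma0Coset N → ℤ)).sum ((g⁻¹ : SL(2, ℤ)) : Gamma0Coset N)).sum := by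
  obtain ⟨B, hBij, hB⟩ := exists_perfect_crossingPairing (N := N)
  -- the identity of carriers `periodHomologyHecke N ≃+ periodHomology N`
  let e : periodHomologyHecke N ≃+ periodHomology N :=
    { toFun := fun x ↦ ⟨x.1, (mem_periodHomologyHecke N).mp x.2⟩
      invFun := fun x ↦ ⟨x.1, (mem_periodHomologyHecke N).mpr x.2⟩
      left_inv := fun x ↦ rfl
      right_inv := fun x ↦ rfl
      map_add' := fun x y ↦ rfl }
  -- transport: `B' x := (B (e x)) ∘ e`
  let post : (periodHomology N →+ ℤ) ≃+ (periodHomologyHecke N →+ ℤ) := e.symm.addMonoidHomCongrLeft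
  refine ⟨(post.toAddMonoidHom.comp B).comp e.toAddMonoidHom, ?_, fun γ γ' D L hD hL ↦ ?_⟩
  · exact post.bijective.comp (hBij.comp e.bijective)
  · exact hB γ γ' D L hD hL

end Transport

end Summit.BirchSwinnertonDyer.BirchSwinnertonDyer.Theorems.ThetaLayerLambdaCongruenceAtTwo

end
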